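/-
Copyright (c) 2026. All rights reserved.
Released under Apache 2.0 license as described in the file LICENSE.
Authors: abc-iut cell, seat abc-iut-L4-t10 (gen 3; block W2-B4, nodes `AbsTopIII:Cor4.5(iii)`, `(v)`:
the compatibility clauses left "recorded, not typed" by `AbsTopIII/AutHolLogFrobenius.lean`).
-/
import Literature.AnabelianGeometry.AbsoluteAnabelian.AbsTopIII.FrobeniusPictureMLFCompatibility
import Literature.AnabelianGeometry.AbsoluteAnabelian.AbsTopIII.AutHolLogFrobenius
import HarnessLib

/-!
# [AbsTopIII] Corollary 4.5 (iii), second clause, and (v), last two sentences — the LITERAL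
# Def 3.5 (ii)/(v) compatibility statements (typed)

S. Mochizuki, *Topics in Absolute Anabelian Geometry III*, Cor. 4.5 pp. 107–110 of the author's kurims
manuscript (lit key `paper:url-5493eb38cbb7`, read on the page: p. 109 l. 2–5 and l. 15–21; bib key
`MochizukiAbsTopIII2015`).  Block W2-B4 of the abc-iut cell (seat abc-iut-L4-t10).

`AbsTopIII/AutHolLogFrobenius.lean` types Cor. 4.5 (i)–(v) over ABSTRACT input data
`Δ : LogFrobeniusData`, `τ : Δ.TelecoreData` as `Cor_4_5 Δ τ := Δ.LogFrobeniusCompatible τ` — literally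
abc-iut-L4-t5's Cor. 3.6 structure, the archimedean case being distinguished inside the data (direction of
`ι_×`, `𝒜 = LinHol`) — and records two clauses as "recorded, not typed (as in Cor. 3.6 (iii)/(v))":

* (iii), second clause (p. 109 l. 3–5): the family of homotopies of `𝔖_log` "is compatible with the
  families of homotopies that constitute the core and telecore structures of (i), (ii)";
* (v), third and fourth sentences (p. 109 l. 15–21): "the self-equivalences in these nexus-classes are
  compatible with the families of homotopies that constitute the cores and observable of (i), (iii);
  these self-equivalences also extend naturally [cf. the technique of extension applied in Definition
  3.5, (vi)] to the diagram of categories [cf. Definition 3.5, (iv), (a)] that constitutes the telecore of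
  (ii), in a fashion that is compatible with both the family of homotopies that constitutes this
  telecore structure [cf. Definition 3.5, (iv), (b)] and the contact structure `ℋ_LH` of (ii)."

These sentences are, word for word (with `ℋ_An ↦ ℋ_LH`), the corresponding sentences of Cor. 3.6 (iii)/(v)
(p. 80), which abc-iut-L4-t5 has since typed LITERALLY over the same abstract data
(`AbsTopIII/FrobeniusPictureMLFCompatibility.lean`: `LogObsCompatCoresStmt`, `LogObsCompatTelecoreStmt τ`,
`ShiftCompatStmt`, `ShiftTelecoreCompatStmt τ` — Def. 3.5 (ii) compatibility read along the embeddings of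
the presentations `𝒟_{≤3}`, `𝒟_{≤n} ∪ {core}`, `𝒟_LH` into `𝒟`, and Def. 3.5 (v) compatibility of the
self-equivalences / their extensions with the families).  Following the typing rule of the block
("imported and never re-declared"), this file NAMES those statements for Cor. 4.5 and assembles the
corollary with all its printed clauses:

* `Cor_4_5_iii_compat Δ τ` — (iii), second clause (cores ∧ telecore halves);
* `Cor_4_5_v_compat Δ τ` — (v), third ∧ fourth sentences;
* `Cor_4_5_full Δ τ := Cor_4_5 Δ τ ∧ Cor_4_5_iii_compat Δ τ ∧ Cor_4_5_v_compat Δ τ`, with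
  `cor_4_5_full_iff` (PROVED, bookkeeping) listing the five items and the two clauses.

For the archimedean data the contact structure `ℋ_LH` is the `ℋ_An`-slot of `τ = ⟨φ_LH, unitor, η_LH⟩`
(`IsContactAn τ`), exactly as in `Cor_4_5_ii := Δ.TelecoreStmt τ`.  HONEST FRAMING: statements only —
typed, NOT proved here (the printed proof, p. 110: "Assertion (v) follows by applying the argument
applied in the proof of Corollary 3.6, (v)"; (iii): "immediate from the definitions", p. 81); nothing
is asserted for the geometric data; nothing here bears on [IUTchIII] Cor. 3.12; typed ≠ discharged.
-/

namespace Literature.AnabelianGeometry.AbsoluteAnabelian.AbsTopIII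

universe u

section Statements

variable (Δ : LogFrobeniusData.{u}) (τ : Δ.TelecoreData)

/-- **Cor. 4.5 (iii), second clause**: the family of homotopies of the observable `𝔖_log` "is compatible
with the families of homotopies that constitute the core and telecore structures of (i), (ii)" — ONE
family on `𝒟` contains the `𝔖_log` family and core families for `(𝒟_{≤4}, ℰ)`, `(𝒟_{≤5}, LinHol)`,
`(𝒟_{≤6}, ℰ)` (abc-iut-L4-t5's `LogObsCompatCoresStmt`), and over a telecore `𝔗_LH` of the printed shape
ONE family on `𝒟_LH` contains the telecore family and the `𝔖_log` family (`LogObsCompatTelecoreStmt`).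
[cite: MochizukiAbsTopIII2015, Corollary 4.5 (iii) p.109] -/
def Cor_4_5_iii_compat : Prop := Δ.LogObsCompatCoresStmt ∧ Δ.LogObsCompatTelecoreStmt τ

/-- **Cor. 4.5 (v), third and fourth sentences**: "the self-equivalences in these nexus-classes are
compatible with the families of homotopies that constitute the cores and observable of (i), (iii)"
(abc-iut-L4-t5's `ShiftCompatStmt`: Def. 3.5 (v) compatibility of every `Φ_m` with a family realising
the cores and `𝔖_log`); "these self-equivalences also extend naturally [cf. the technique of extension
applied in Definition 3.5, (vi)] to the diagram of categories … that constitutes the telecore of (ii),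
in a fashion that is compatible with both the family of homotopies that constitutes this telecore
structure … and the contact structure `ℋ_LH` of (ii)" (`ShiftTelecoreCompatStmt τ`).
[cite: MochizukiAbsTopIII2015, Corollary 4.5 (v) p.109] -/
def Cor_4_5_v_compat : Prop := Δ.ShiftCompatStmt ∧ Δ.ShiftTelecoreCompatStmt τ

/-- **Corollary 4.5 with all its printed clauses**: the five items as typed in
`AutHolLogFrobenius.lean` (`Cor_4_5 = LogFrobeniusCompatible`) together with the compatibility clause of
(iii) and the last two sentences of (v).  Named `Prop`; nothing is asserted.
[cite: MochizukiAbsTopIII2015, Corollary 4.5 pp.107–109] -/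
def Cor_4_5_full : Prop := Cor_4_5 Δ τ ∧ Cor_4_5_iii_compat Δ τ ∧ Cor_4_5_v_compat Δ τ

/-- `Cor_4_5_full` is the conjunction of the five printed items and the two compatibility clauses.
[cite: MochizukiAbsTopIII2015, Corollary 4.5 pp.107–109] -/
theorem cor_4_5_full_iff :
    Cor_4_5_full Δ τ ↔
      (Cor_4_5_i Δ ∧ Cor_4_5_ii Δ τ ∧ Cor_4_5_iii Δ ∧ Cor_4_5_iv Δ τ ∧ Cor_4_5_v Δ) ∧
        (Δ.LogObsCompatCoresStmt ∧ Δ.LogObsCompatTelecoreStmt τ) ∧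
        (Δ.ShiftCompatStmt ∧ Δ.ShiftTelecoreCompatStmt τ) := by
  unfold Cor_4_5_full Cor_4_5_iii_compat Cor_4_5_v_compat
  rw [cor_4_5_iff]

/-- The full form implies the five-item form. [cite: MochizukiAbsTopIII2015, Corollary 4.5 pp.107–109] -/
theorem Cor_4_5_full.cor_4_5 {Δ : LogFrobeniusData.{u}} {τ : Δ.TelecoreData}
    (h : Cor_4_5_full Δ τ) : Cor_4_5 Δ τ := h.1

/-- (iii) in full: the observable `𝔖_log` exists (first clause, `Cor_4_5_iii`) and its family is
compatible with the cores and the telecore (second clause).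
[cite: MochizukiAbsTopIII2015, Corollary 4.5 (iii) pp.108–109] -/
theorem Cor_4_5_full.iii {Δ : LogFrobeniusData.{u}} {τ : Δ.TelecoreData} (h : Cor_4_5_full Δ τ) :
    Cor_4_5_iii Δ ∧ Cor_4_5_iii_compat Δ τ :=
  ⟨((cor_4_5_iff Δ τ).mp h.1).2.2.1, h.2.1⟩

/-- (v) in full: nexus, total `□`-rigidity and the `ℤ`-action (`Cor_4_5_v`) together with the
compatibility and extension sentences. [cite: MochizukiAbsTopIII2015, Corollary 4.5 (v) p.109] -/
theorem Cor_4_5_full.v {Δ : LogFrobeniusData.{u}} {τ : Δ.TelecoreData} (h : Cor_4_5_full Δ τ) :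
    Cor_4_5_v Δ ∧ Cor_4_5_v_compat Δ τ :=
  ⟨((cor_4_5_iff Δ τ).mp h.1).2.2.2.2, h.2.2⟩

end Statements

end Literature.AnabelianGeometry.AbsoluteAnabelian.AbsTopIII
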